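import Literature.NumberTheory.EllipticCurves.HidaFamilyGaloisRepDatum
import Literature.NumberTheory.EllipticCurves.OchiaiTwoVariableSelmerDual
import Literature.NumberTheory.GaloisRepresentations.NearlyOrdinaryPresentationProofs
import Literature.AlgebraicGeometry.Resolution.RegularLocalRingsQuotient
import Literature.RingTheory.KrullDimension.AffineDimension
import Summits.BirchSwinnertonDyer.BirchSwinnertonDyer.Theorems.OneSidedTwistSqueezeX9KatoDivisibilityX9ULedgerDefs
import Mathlib.RingTheory.Ideal.GoingUp

set_option autoImplicit false

-- the summit and its single problem are both named `BirchSwinnertonDyer` (registry layout D-0017)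
set_option linter.dupNamespace false

/-!
# `P_W` is principal under (Reg): height-one primes of a two-dimensional factorial local domain
# (helpers for crux stmt-BirchSwinnertonDyer-20547 `KatoDivisibilityX9`, line `prime_adapted_tau`, stub 3 (U))

Port (verbatim, re-homed) of §G of the bsd-f3-mu cell's kernel-checked sketch `Sketch71.lean` v5 f376123484d02b28
(planner-bsd-f3-mu-desc g71; the argument is desc g64's D64 §2, re-run over a UFD hypothesis; port plan PORT-PLAN-72 file
P6, desc g72).  With (Reg) := `Ochiai2006.IsRegular p 𝕀` (tree: `∃ 𝒪` DVR, `𝕀 ≃+* 𝒪⟦X⟧`) and `D.PrincipalPointW` of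
`…ULedgerDefs.lean` (`∃ ϖ, Prime ϖ ∧ ker specW = (ϖ)`):

* `eq_span_singleton_of_dim_two` — in a factorial local domain of Krull dimension `2`, a prime `P` with
  `⊥ ≠ P ≠ 𝔪` is principal with a prime generator (height one + UFD);
* `ringKrullDim_eq_two_of_isRegular` — `dim 𝕀 = 2` under (Reg) (tree `ringKrullDim_mvPowerSeries_dvr`);
* `injective_algebraMap_of_isRegular` — (Reg) ⟹ (inj) `Λ ↪ 𝕀` for `𝕀` module-finite over `Λ = ℤ_p⟦X⟧` (a non-zero
  `f` in the kernel would make the two-dimensional `𝕀` integral over the at most one-dimensional `Λ/(f)`);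
* `HidaFamilyGaloisRepDatum.principalPointW_of_isRegular` — for every Hida datum `D` over a regular `𝕀`,
  `P_W = ker specW` is principal: `X ∈ P_W ≠ ⊥` by (inj), `p ∈ 𝔪 ∖ P_W`, so `P_W` is a height-one prime of the
  factorial two-dimensional `𝕀`.

No ledger item is closed here; BSD is proved for no curve.  References: [Ochiai2006] §3 (the condition (Reg));
[Matsumura1987] Thm. 20.1 (regular ⟹ UFD), §5 (dimension of quotients).
-/

noncomputable section

open scoped Classical

namespace Summit.BirchSwinnertonDyer.BirchSwinnertonDyer.Theorems.OneSidedTwistSqueezeX9KatoDivisibilityX9ULedger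

open Literature.NumberTheory.EllipticCurves Literature.NumberTheory.GaloisRepresentations

/-- Height-one primes of a two-dimensional factorial local domain are principal (D64 §2, UFD form). -/
theorem eq_span_singleton_of_dim_two {R : Type*} [CommRing R] [IsDomain R] [IsLocalRing R]
    [UniqueFactorizationMonoid R] (hdim : ringKrullDim R = 2)
    {P : Ideal R} [P.IsPrime] (hP0 : P ≠ ⊥) (hPm : P ≠ IsLocalRing.maximalIdeal R) :
    ∃ π : R, Prime π ∧ P = Ideal.span {π} := by
  obtain ⟨π, hπP, hπ⟩ := Ideal.IsPrime.exists_mem_prime_of_ne_bot ‹P.IsPrime› hP0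
  have hlt : P < IsLocalRing.maximalIdeal R :=
    lt_of_le_of_ne (IsLocalRing.le_maximalIdeal Ideal.IsPrime.ne_top') hPm
  have hm : (IsLocalRing.maximalIdeal R).height = 2 := by
    have := IsLocalRing.maximalIdeal_height_eq_ringKrullDim (R := R)
    rw [hdim, WithBot.coe_eq_ofNat] at this
    exact this
  haveI : (IsLocalRing.maximalIdeal R).FiniteHeight := by
    rw [Ideal.finiteHeight_iff, hm]
    exact Or.inr (by decide)
  have hPlt := Ideal.height_strict_mono_of_isPrime_of_isPrime hlt
  rw [hm] at hPlt
  have hP1 : P.height = 1 := by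
    have hne : P.height ≠ 0 := fun h0 => hP0 ((Ideal.height_eq_zero_iff_eq_bot).mp h0)
    have hfin : P.height ≠ ⊤ := ne_top_of_lt hPlt
    obtain ⟨m, hm'⟩ := ENat.ne_top_iff_exists.mp hfin
    rw [← hm'] at hPlt hne ⊢
    have h2 : m < 2 := by exact_mod_cast hPlt
    have h0 : m ≠ 0 := fun h => hne (by simp [h])
    have : m = 1 := by omega
    simp [this]
  exact ⟨π, hπ, Ideal.eq_span_singleton_of_height_eq_one hP1 hπP hπ⟩

/-- `dim 𝕀 = 2` under (Reg) (tree: `dim 𝒪⟦X₀,…,X_{n-1}⟧ = n + 1`; D64 `ringKrullDim_powerSeries_dvr`). -/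
theorem ringKrullDim_eq_two_of_isRegular {p : ℕ} [Fact p.Prime] {I : Type} [CommRing I]
    (hreg : Ochiai2006.IsRegular p I) : ringKrullDim I = 2 := by
  obtain ⟨𝒪, _, _, _, _, _, _, ⟨e⟩⟩ := hreg
  rw [ringKrullDim_eq_of_ringEquiv e,
    ← ringKrullDim_eq_of_ringEquiv (MvPowerSeries.renameEquiv 𝒪 finOneEquiv.symm).toRingEquiv.symm,
    Literature.NumberTheory.GaloisRepresentations.NearlyOrdinaryPresentationCA.ringKrullDim_mvPowerSeries_dvr 𝒪 1]
  rfl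

/-- **(Reg) ⟹ (inj)** (D64 `injective_algebraMap_of_isRegular`, reproduced: a non-zero `f` in the kernel would
make the two-dimensional `𝕀` integral over the at most one-dimensional `Λ/(f)`). -/
theorem injective_algebraMap_of_isRegular {p : ℕ} [Fact p.Prime] {I : Type} [CommRing I]
    [Algebra (IwasawaAlgebra p) I] [Module.Finite (IwasawaAlgebra p) I] (H : Ochiai2006.IsRegular p I) :
    Function.Injective (algebraMap (IwasawaAlgebra p) I) := by
  have hdimI : ringKrullDim I = 2 := ringKrullDim_eq_two_of_isRegular H
  obtain ⟨𝒪, _, _, _, _, _, _, ⟨e⟩⟩ := H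
  haveI : IsDomain I := MulEquiv.isDomain (PowerSeries 𝒪) e.toMulEquiv
  rw [injective_iff_map_eq_zero]
  intro f hf
  by_contra hf0
  have hle : Ideal.span {f} ≤ RingHom.ker (algebraMap (IwasawaAlgebra p) I) := by
    rw [Ideal.span_singleton_le_iff_mem, RingHom.mem_ker]; exact hf
  have hne : Ideal.span {f} ≠ (⊤ : Ideal (IwasawaAlgebra p)) := by
    intro ht
    have h1 : (1 : IwasawaAlgebra p) ∈ RingHom.ker (algebraMap (IwasawaAlgebra p) I) :=
      hle (ht ▸ Submodule.mem_top)
    rw [RingHom.mem_ker, map_one] at h1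
    exact one_ne_zero h1
  haveI := Literature.AlgebraicGeometry.Resolution.isLocalRing_quotient hne
  let φ : (IwasawaAlgebra p) ⧸ Ideal.span {f} →+* I :=
    Ideal.Quotient.lift (Ideal.span {f}) (algebraMap (IwasawaAlgebra p) I) (fun a ha => hle ha)
  have hφ : φ.comp (Ideal.Quotient.mk (Ideal.span {f})) = algebraMap (IwasawaAlgebra p) I :=
    RingHom.ext fun a => Ideal.Quotient.lift_mk (Ideal.span {f}) _ (fun a ha => hle ha)
  letI : Algebra ((IwasawaAlgebra p) ⧸ Ideal.span {f}) I := φ.toAlgebra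
  haveI : Algebra.IsIntegral (IwasawaAlgebra p) I := Algebra.IsIntegral.of_finite _ _
  haveI : Algebra.IsIntegral ((IwasawaAlgebra p) ⧸ Ideal.span {f}) I := by
    refine ⟨fun x => ?_⟩
    obtain ⟨P, hPm, hPx⟩ := Algebra.IsIntegral.isIntegral (R := IwasawaAlgebra p) x
    refine ⟨P.map (Ideal.Quotient.mk (Ideal.span {f})), hPm.map _, ?_⟩
    rw [Polynomial.eval₂_map, RingHom.algebraMap_toAlgebra, hφ]
    exact hPx
  have h1 : ringKrullDim I ≤ ringKrullDim ((IwasawaAlgebra p) ⧸ Ideal.span {f}) :=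
    Literature.RingTheory.KrullDimension.ringKrullDim_le_of_isIntegral
  have h2 := ringKrullDim_quotient_succ_le_of_nonZeroDivisor (mem_nonZeroDivisors_of_ne_zero hf0)
  have h3 : ringKrullDim (IwasawaAlgebra p) = 2 := IwasawaAlgebra.ringKrullDim_eq_two p
  obtain ⟨n, hn⟩ := Literature.AlgebraicGeometry.Resolution.exists_nat_cast_eq_ringKrullDim
    (R := (IwasawaAlgebra p) ⧸ Ideal.span {f})
  rw [hdimI, hn] at h1
  rw [hn, h3] at h2
  have h1' : 2 ≤ n := by exact_mod_cast h1
  have h2' : n + 1 ≤ 2 := by exact_mod_cast h2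
  omega

end Summit.BirchSwinnertonDyer.BirchSwinnertonDyer.Theorems.OneSidedTwistSqueezeX9KatoDivisibilityX9ULedger

namespace Literature.NumberTheory.EllipticCurves.HidaFamilyGaloisRepDatum

open Literature.NumberTheory.EllipticCurves Literature.NumberTheory.GaloisRepresentations
open Summit.BirchSwinnertonDyer.BirchSwinnertonDyer.Theorems.OneSidedTwistSqueezeX9KatoDivisibilityX9ULedger

/-- **`PrincipalPointW` under (Reg)** — KERNEL: `ker specW` is a height-one prime of the factorial two-dimensional
`𝕀`, hence principal with a prime generator. Inputs: fields (i) `moduleFinite`, (i) `charP_residueField`,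
(v) `specW_algebraMap` of the datum, and (Reg). -/
theorem principalPointW_of_isRegular {W : WeierstrassCurve ℚ} {p : ℕ} [Fact p.Prime] {I : Type} [CommRing I]
    [IsDomain I] [IsLocalRing I] [TopologicalSpace I] [IsTopologicalRing I] [Algebra (IwasawaAlgebra p) I]
    (D : HidaFamilyGaloisRepDatum W p I) (hreg : Ochiai2006.IsRegular p I) : D.PrincipalPointW := by
  haveI := hreg.uniqueFactorizationMonoid
  have hdim : ringKrullDim I = 2 := ringKrullDim_eq_two_of_isRegular hreg
  haveI := D.moduleFinite
  have hinj := injective_algebraMap_of_isRegular (p := p) (I := I) hreg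
  haveI : (RingHom.ker D.specW).IsPrime := RingHom.ker_isPrime _
  have hP0 : RingHom.ker D.specW ≠ ⊥ := by
    intro h0
    have hX : algebraMap (IwasawaAlgebra p) I PowerSeries.X ∈ RingHom.ker D.specW := by
      rw [RingHom.mem_ker]; exact D.specW_algebraMap_X
    rw [h0, Ideal.mem_bot] at hX
    exact PowerSeries.X_ne_zero (hinj (by rw [hX, map_zero]))
  have hPm : RingHom.ker D.specW ≠ IsLocalRing.maximalIdeal I := by
    intro hm
    have hpm : ((p : ℕ) : I) ∈ IsLocalRing.maximalIdeal I := by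
      haveI := D.charP_residueField
      rw [← IsLocalRing.residue_eq_zero_iff, map_natCast]
      exact CharP.cast_eq_zero _ p
    rw [← hm, RingHom.mem_ker, map_natCast] at hpm
    exact (Nat.cast_ne_zero.mpr (Fact.out : p.Prime).ne_zero) hpm
  obtain ⟨π, hπ, hP⟩ := eq_span_singleton_of_dim_two hdim hP0 hPm
  exact ⟨π, hπ, hP⟩

end Literature.NumberTheory.EllipticCurves.HidaFamilyGaloisRepDatum
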